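import Summits.QuantumFields.BalabanUV.T4Continuum.Support.NE3TangentCovariantStructure
import Summits.QuantumFields.BalabanUV.T4Continuum.Support.AveragingDeficitLocality
import Literature.MathematicalPhysics.QuantumFieldTheory.Balaban1983to89.B7Eq92Concrete
import Literature.MathematicalPhysics.QuantumFieldTheory.Balaban1983to89.B14Eq372ContourBCH
import HarnessLib

/-!
# Support | NE7 (gen 96, ROAD-G96 §9∕§11, first brick of (Γ3)): THE BLOCK FRAME TO SECOND ORDER —
# `‖log (R_{0,y}e^{Ad ψ})(Γ) − (δ_ψ V₀)(Γ)‖ ≤ 2·(Σ_{b⊂Γ}‖ψ_b‖)²` along every positively oriented contour with `Σ_{b⊂Γ}‖ψ_b‖ ≤ 1∕20`, hence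
# `‖Fcov L V₀ (e^{Ad ψ}) y − frameLin L V₀ ψ y‖ ≤ 2·L^{−d}·Σ_{x ∈ B(y)} (Σ_{b ⊂ Γ_{y,x}}‖ψ_b‖)²` (the one-block frame (62)∕(82) of [Balaban1985Averaging] minus its linearisation)

Cell `pub-balaban`, rung (B)+1 sub-cell t4, lineage `b2b-balaban-t4-ne7-p1` (CRUX PROVER NE7 #1 = OWNER of row NE7), generation 96; memo `t4/b2b-balaban-t4-ne7-p1-g96/ROAD-G96.md`
§9∕§11 (Γ3).  Over [Balaban1988Convergent] (3.72)'s kernel BCH-along-a-contour `B14.Eq372ContourBCH.norm_mlog_holonomy_sub_le` (`‖log Πe^{X_b} − ΣX_b − ½Σ_{b<b′}[X_b,X_{b′}]‖ ≤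
28(Σ‖X_b‖)³`, `norm_pairComm_le`), [Balaban1985Averaging] (58) `B7Eq92Concrete.tHol` (the `R₀`-twisted transport; front recursion for a positive letter proved here:
`tHol V₀ V₁ x (b::Γ) = (V₁V₀)_b · tHol V₀ V₁ x′ Γ · V₀_b⁻¹`), (62)∕(82) `Fcov`, the tree's linearised transport `AveragingDeficitTransport.dhol` and linearised frame
`BlockAveragePushDirSplit.frameLin`, and `AveragingDeficitLocality.expUnit_Ad` (`e^{Ad_u X} = u e^X u⁻¹`).

WHY (memo §§7, 10, 11).  ROAD-Γ's letter (Γ3) bounds the accumulated frame defect `log v_{k+1}` of a sup-small competitor by LOCAL bilinear quantities; `v_{k+1}` is a product over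
levels of one-block frames `wframe = exp Fcov` (`vcov_succ`), so the first brick is the expansion of ONE block frame to second order with an explicit, path-weighted bound — this file:
for the perturbation `V₁ = e^{Ad_{V₀}ψ}` (i.e. `V₁V₀ = V₀e^{ψ}`, the tree's `vary V₀ ψ 1`; `relPert_eq_expCfg_adField`), the twisted transport along a positively oriented contour IS
the ordered product `Π_b exp(Ad-transported ψ_b)` whose additive reading is EXACTLY `(δ_ψ V₀)(Γ) = dhol V₀ ψ x Γ` and whose ℓ¹ size is `lnorm ψ x Γ` (unitary `V₀`), so (3.72)'s
kernel gives `log tHol = dhol + O((Σ‖ψ_b‖)²)` with the constant `2` (`½ + 28∕20 ≤ 2`), and averaging over the block gives the frame statement with the weight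
`L^{−d}·#{paths through b}·|path|` structure the memo's (Γ3) uses (`(Σ_{b⊂Γ}‖ψ_b‖)² ≤ |Γ|·Σ_{b⊂Γ}‖ψ_b‖²` is left to the consumer).
WHAT ([folklore]; 0 def, 0 sorry).  §1 `tHol_cons_true` (front recursion), `exists_list_of_pos` (for a positively oriented word: a list `l` with `holonomy l = tHol`, `contourVar l =
dhol`, `normSum l = lnorm` — by induction, conjugating the tail by `Ad_{V₀(b)}`; no `def`), `treeWord_pos` (tree contours of `boxVec` are positively oriented).
§2 **`norm_mlog_tHol_sub_dhol_le`** (the display, first line).  §3 **`norm_Fcov_sub_frameLin_le`** (the display, second line) and the sup form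
`norm_Fcov_sub_frameLin_le_of_sup` (`‖ψ‖ ≤ β`, `dLβ ≤ 1∕20` ⇒ `≤ 2(dLβ)²`).
HONEST FRAMING (page 1): lattice group calculus on OUR frame over two printed-type kernel lemmas; nothing of Bałaban's asserted; the multi-level assembly of (Γ3), (Γ4), `hdecomp♭`, NE7 NOT
proved; spine 0∕9; finite T⁴ rung (B)+1 — NOT infinite volume, NOT mass gap, NOT `BetaPertH`, NOT Clay.  Continuum YM on T⁴ ⇐ BetaPertH ∧ nine spine estimates (0/9 proved); BetaPertH ⇐
(D1) ∧ (D4) ∧ CAP+tail; G-an2-4 gates asym, D1 and NE2/3/4.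
-/

set_option autoImplicit false

open scoped BigOperators Matrix Matrix.Norms.L2Operator
open NormedSpace Finset

namespace Summit.QuantumFields.BalabanUV.T4Continuum.NE7BlockFrameSecondOrder

open Literature.MathematicalPhysics.QuantumFieldTheory.Balaban1983to89
open B7Prop1Explicit B7Prop2Explicit MatrixLog
open B7Prop3Flat (expCfg)
open B7Eq92Concrete (tHol Fcov)
open B14.Eq372ContourBCH (holonomy contourVar pairComm normSum normSum_nonneg normSum_cons norm_pairComm_le norm_mlog_holonomy_sub_le)
open T4AveragingDeficitWall (Ad IsUnitaryCfg)
open AveragingDeficitTransport (dhol dhol_nil dhol_cons dstep lnorm lnorm_nil lnorm_cons norm_Ad_of_unitary)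
open AveragingDeficitNearIdentity (Ad_add Ad_mul_Ad Ad_zero lnorm_nonneg)
open AveragingDeficitLocality (expUnit_Ad)
open BlockAveragePushDirSplit (frameLin)

noncomputable section

variable {d : ℕ} {n : Type*} [Fintype n] [DecidableEq n]

/-! ## §1 The twisted transport along a positively oriented contour is an ordered product of transported exponentials -/

/-- **FRONT RECURSION OF (58) FOR A POSITIVE LETTER**: `tHol V₀ V₁ x ((μ,true) :: Γ) = (V₁V₀)(x,μ) · tHol V₀ V₁ (x+e_μ) Γ · V₀(x,μ)⁻¹`. [folklore] -/
theorem tHol_cons_true (V₀ V₁ : Site d → Fin d → (Matrix n n ℂ)ˣ) (x : Site d) (μ : Fin d) (w : List (Letter d)) :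
    tHol V₀ V₁ x ((μ, true) :: w) = (V₁ * V₀) x μ * tHol V₀ V₁ (x + e μ) w * (V₀ x μ)⁻¹ := by
  unfold tHol
  simp only [hol_cons, stepHol_true, Letter.vec_true, mul_inv_rev]
  group

/-- `Ad` distributes over a list product of exponentials: `(l.map (exp ∘ Ad u)).prod = Ad u (l.map exp).prod`. [folklore] -/
theorem prod_map_exp_Ad (u : (Matrix n n ℂ)ˣ) (l : List (Matrix n n ℂ)) :
    ((l.map (Ad u)).map exp).prod = Ad u ((l.map exp).prod) := by
  induction l with
  | nil => simp [Ad]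
  | cons X t ih =>
      simp only [List.map_cons, List.prod_cons, ih]
      have h : exp (Ad u X) = Ad u (exp X) := by
        have := congrArg (fun v : (Matrix n n ℂ)ˣ => (v : Matrix n n ℂ)) (expUnit_Ad u X)
        simpa [val_expUnit, Ad] using this
      rw [h, Ad_mul_Ad]

/-- `Ad` distributes over a list sum. [folklore] -/
theorem sum_map_Ad (u : (Matrix n n ℂ)ˣ) (l : List (Matrix n n ℂ)) : (l.map (Ad u)).sum = Ad u l.sum := by
  induction l with
  | nil => simp
  | cons X t ih => simp only [List.map_cons, List.sum_cons, ih, Ad_add]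

/-- `normSum` is `Ad`-invariant for unitary `u`. [folklore] -/
theorem normSum_map_Ad {u : (Matrix n n ℂ)ˣ} (hu : u ∈ unitaryUnits (Matrix n n ℂ)) (l : List (Matrix n n ℂ)) :
    normSum (l.map (Ad u)) = normSum l := by
  induction l with
  | nil => simp [normSum]
  | cons X t ih => rw [List.map_cons, normSum_cons, normSum_cons, ih, norm_Ad_of_unitary hu]

/-- **THE TWISTED TRANSPORT OF `e^{Ad ψ}` ALONG A POSITIVELY ORIENTED CONTOUR IS AN ORDERED PRODUCT OF EXPONENTIALS** whose additive reading is the linearised transport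
and whose ℓ¹ size is `lnorm` (unitary `V₀`): for every word `Γ` of positive letters and every `x` there is a list `l` with `holonomy l = tHol V₀ (e^{Ad_{V₀}ψ}) x Γ`,
`contourVar l = dhol V₀ ψ x Γ`, `normSum l = lnorm ψ x Γ` (induction; the tail is conjugated by `Ad_{V₀(b)}`). [folklore] -/
theorem exists_list_of_pos {V₀ : Site d → Fin d → (Matrix n n ℂ)ˣ} (hV : IsUnitaryCfg V₀) (ψ : Site d → Fin d → Matrix n n ℂ) :
    ∀ (w : List (Letter d)) (x : Site d), (∀ l ∈ w, l.2 = true) →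
      ∃ l : List (Matrix n n ℂ), holonomy l = ((tHol V₀ (expCfg (fun x' μ' => Ad (V₀ x' μ') (ψ x' μ'))) x w : (Matrix n n ℂ)ˣ) : Matrix n n ℂ) ∧
        contourVar l = dhol V₀ ψ x w ∧ normSum l = lnorm ψ x w
  | [], x, _ => ⟨[], by simp [holonomy, tHol], by simp [contourVar], by simp [normSum]⟩
  | (μ, b) :: w, x, hw => by
      have hb : b = true := hw (μ, b) (List.mem_cons_self)
      subst hb
      obtain ⟨t, ht, hc, hn⟩ := exists_list_of_pos hV ψ w (x + e μ) (fun l hl => hw l (List.mem_cons_of_mem _ hl))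
      refine ⟨Ad (V₀ x μ) (ψ x μ) :: t.map (Ad (V₀ x μ)), ?_, ?_, ?_⟩
      · -- holonomy
        have he : exp (Ad (V₀ x μ) (ψ x μ)) = Ad (V₀ x μ) (exp (ψ x μ)) := by
          have := congrArg (fun v : (Matrix n n ℂ)ˣ => (v : Matrix n n ℂ)) (expUnit_Ad (V₀ x μ) (ψ x μ))
          simpa [val_expUnit, Ad] using this
        rw [tHol_cons_true]
        simp only [holonomy, List.map_cons, List.prod_cons]
        rw [prod_map_exp_Ad, show (t.map exp).prod = holonomy t from rfl, ht, he, Ad_mul_Ad]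
        simp only [Pi.mul_apply, Units.val_mul]
        rw [show ((expCfg (fun x' μ' => Ad (V₀ x' μ') (ψ x' μ')) x μ : (Matrix n n ℂ)ˣ) : Matrix n n ℂ) = exp (Ad (V₀ x μ) (ψ x μ)) from rfl, he]
        unfold Ad
        simp only [mul_assoc, Units.inv_mul_cancel_left]
      · -- additive reading
        simp only [contourVar, List.sum_cons] at hc ⊢
        rw [sum_map_Ad, hc, dhol_cons]
        simp [dstep, stepHol_true]
      · -- ℓ¹ size
        rw [normSum_cons, normSum_map_Ad (hV x μ), hn, lnorm_cons, norm_Ad_of_unitary (hV x μ)]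
        simp

/-- Tree contours of non-negative displacements are positively oriented. [folklore] -/
theorem treeWord_pos {L : ℕ} (r : Fin d → Fin L) : ∀ l ∈ treeWord (boxVec L r), l.2 = true := by
  intro l hl
  unfold treeWord at hl
  simp only [List.mem_flatMap, List.mem_reverse, List.mem_finRange, true_and] at hl
  obtain ⟨κ, hκ⟩ := hl
  simp only [boxVec, seg_natCast, List.mem_replicate] at hκ
  rw [hκ.2]

/-! ## §2 The twisted transport to second order -/

/-- **THE TWISTED TRANSPORT OF `e^{Ad ψ}` TO SECOND ORDER**: along a positively oriented contour `Γ` from `x` with `Σ_{b⊂Γ}‖ψ_b‖ ≤ 1∕20` at a unitary `V₀`,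
`‖log tHol V₀ (e^{Ad_{V₀}ψ}) x Γ − dhol V₀ ψ x Γ‖ ≤ 2·(lnorm ψ x Γ)²` ([Balaban1988Convergent] (3.72)'s kernel + `‖½Σ[·,·]‖ ≤ ½(Σ‖·‖)²`). [folklore] -/
theorem norm_mlog_tHol_sub_dhol_le {V₀ : Site d → Fin d → (Matrix n n ℂ)ˣ} (hV : IsUnitaryCfg V₀) (ψ : Site d → Fin d → Matrix n n ℂ)
    (w : List (Letter d)) (x : Site d) (hw : ∀ l ∈ w, l.2 = true) (hs : lnorm ψ x w ≤ 1 / 20) :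
    ‖mlog ((tHol V₀ (expCfg (fun x' μ' => Ad (V₀ x' μ') (ψ x' μ'))) x w : (Matrix n n ℂ)ˣ) : Matrix n n ℂ) - dhol V₀ ψ x w‖ ≤ 2 * lnorm ψ x w ^ 2 := by
  obtain ⟨l, hl, hc, hn⟩ := exists_list_of_pos hV ψ w x hw
  rw [← hl, ← hc, ← hn]
  rw [← hn] at hs
  have h3 := norm_mlog_holonomy_sub_le l hs
  have h2 := norm_pairComm_le l
  have h0 := normSum_nonneg l
  have hhalf : ‖(2⁻¹ : ℂ) • pairComm l‖ ≤ 1 / 2 * normSum l ^ 2 := by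
    rw [norm_smul]
    have : ‖(2⁻¹ : ℂ)‖ = 1 / 2 := by simp
    rw [this]
    exact mul_le_mul_of_nonneg_left h2 (by norm_num)
  calc ‖mlog (holonomy l) - contourVar l‖
      = ‖(mlog (holonomy l) - contourVar l - (2⁻¹ : ℂ) • pairComm l) + (2⁻¹ : ℂ) • pairComm l‖ := by rw [sub_add_cancel]
    _ ≤ 28 * normSum l ^ 3 + 1 / 2 * normSum l ^ 2 := (norm_add_le _ _).trans (add_le_add h3 hhalf)
    _ ≤ 2 * normSum l ^ 2 := by nlinarith [pow_nonneg h0 2]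

/-! ## §3 The block frame to second order -/

/-- **THE ONE-BLOCK FRAME (62)∕(82) TO SECOND ORDER**: for `1 ≤ L`, a unitary `V₀`, and `ψ` with `lnorm ψ y Γ_{y,x} ≤ 1∕20` on every tree contour of the block of `y`,
`‖Fcov L V₀ (e^{Ad_{V₀}ψ}) y − frameLin L V₀ ψ y‖ ≤ 2·L^{−d}·Σ_{x ∈ B(y)} (lnorm ψ y Γ_{y,x})²`. [folklore] -/
theorem norm_Fcov_sub_frameLin_le {L : ℕ} {V₀ : Site d → Fin d → (Matrix n n ℂ)ˣ} (hV : IsUnitaryCfg V₀) (ψ : Site d → Fin d → Matrix n n ℂ)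
    (y : Site d) (hs : ∀ r : Fin d → Fin L, lnorm ψ y (treeWord (boxVec L r)) ≤ 1 / 20) :
    ‖Fcov L V₀ (expCfg (fun x' μ' => Ad (V₀ x' μ') (ψ x' μ'))) y - frameLin L V₀ ψ y‖
      ≤ 2 * ((L : ℝ) ^ d)⁻¹ * ∑ r : Fin d → Fin L, lnorm ψ y (treeWord (boxVec L r)) ^ 2 := by
  letI : CStarAlgebra (Matrix n n ℂ) := {}
  unfold Fcov frameLin
  rw [← Finset.sum_sub_distrib]
  have hterm : ∀ r : Fin d → Fin L,
      ‖(((L : ℝ) ^ d)⁻¹) • mlog ((tHol V₀ (expCfg (fun x' μ' => Ad (V₀ x' μ') (ψ x' μ'))) y (treeWord (boxVec L r)) : (Matrix n n ℂ)ˣ) : Matrix n n ℂ)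
          - (((L : ℝ) ^ d)⁻¹) • dhol V₀ ψ y (treeWord (boxVec L r))‖
        ≤ ((L : ℝ) ^ d)⁻¹ * (2 * lnorm ψ y (treeWord (boxVec L r)) ^ 2) := by
    intro r
    rw [← smul_sub, norm_smul, Real.norm_eq_abs, abs_of_nonneg (by positivity)]
    exact mul_le_mul_of_nonneg_left (norm_mlog_tHol_sub_dhol_le hV ψ _ y (treeWord_pos r) (hs r)) (by positivity)
  calc ‖∑ r : Fin d → Fin L, ((((L : ℝ) ^ d)⁻¹) • mlog ((tHol V₀ (expCfg (fun x' μ' => Ad (V₀ x' μ') (ψ x' μ'))) y (treeWord (boxVec L r)) : (Matrix n n ℂ)ˣ) : Matrix n n ℂ)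
          - (((L : ℝ) ^ d)⁻¹) • dhol V₀ ψ y (treeWord (boxVec L r)))‖
      ≤ ∑ r : Fin d → Fin L, ((L : ℝ) ^ d)⁻¹ * (2 * lnorm ψ y (treeWord (boxVec L r)) ^ 2) := (norm_sum_le _ _).trans (Finset.sum_le_sum fun r _ => hterm r)
    _ = 2 * ((L : ℝ) ^ d)⁻¹ * ∑ r : Fin d → Fin L, lnorm ψ y (treeWord (boxVec L r)) ^ 2 := by rw [← Finset.mul_sum, Finset.mul_sum, Finset.mul_sum]; refine Finset.sum_congr rfl fun r _ => ?_; ring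

/-- **SUP FORM**: if `‖ψ_b‖ ≤ β` everywhere and `d·L·β ≤ 1∕20`, then `‖Fcov L V₀ (e^{Ad_{V₀}ψ}) y − frameLin L V₀ ψ y‖ ≤ 2·(dLβ)²` (every tree contour has at most `dL` bonds,
`BlockAverageDbarLinNorms.lnorm_le_length_mul_sup`-type count done inline). [folklore] -/
theorem norm_Fcov_sub_frameLin_le_of_sup {L : ℕ} (hL : 1 ≤ L) {V₀ : Site d → Fin d → (Matrix n n ℂ)ˣ} (hV : IsUnitaryCfg V₀)
    {ψ : Site d → Fin d → Matrix n n ℂ} {β : ℝ} (hβ : 0 ≤ β) (hψ : ∀ (x : Site d) (κ : Fin d), ‖ψ x κ‖ ≤ β) (hsmall : (d : ℝ) * L * β ≤ 1 / 20) (y : Site d) :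
    ‖Fcov L V₀ (expCfg (fun x' μ' => Ad (V₀ x' μ') (ψ x' μ'))) y - frameLin L V₀ ψ y‖ ≤ 2 * ((d : ℝ) * L * β) ^ 2 := by
  letI : CStarAlgebra (Matrix n n ℂ) := {}
  -- `lnorm` along a word is at most `|word|·β`
  have hlen : ∀ (w : List (Letter d)) (x : Site d), lnorm ψ x w ≤ w.length * β := by
    intro w
    induction w with
    | nil => intro x; simp
    | cons l w ih =>
        intro x
        rw [lnorm_cons, List.length_cons, Nat.cast_succ]
        have := hψ (if l.2 then x else x + l.vec) l.1
        have := ih (x + l.vec)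
        linarith
  have htree : ∀ r : Fin d → Fin L, lnorm ψ y (treeWord (boxVec L r)) ≤ (d : ℝ) * L * β := by
    intro r
    refine (hlen _ y).trans ?_
    have h := l1_boxVec_le L r
    rw [← length_treeWord] at h
    have : ((treeWord (boxVec L r)).length : ℝ) ≤ (d : ℝ) * L := by exact_mod_cast h
    nlinarith
  have hs : ∀ r : Fin d → Fin L, lnorm ψ y (treeWord (boxVec L r)) ≤ 1 / 20 := fun r => (htree r).trans hsmall
  refine (norm_Fcov_sub_frameLin_le hV ψ y hs).trans ?_
  have hcard : (Finset.univ : Finset (Fin d → Fin L)).card = L ^ d := by simp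
  have h0 : ∀ r : Fin d → Fin L, 0 ≤ lnorm ψ y (treeWord (boxVec L r)) := fun r => lnorm_nonneg ψ y _
  have hsum : ∑ r : Fin d → Fin L, lnorm ψ y (treeWord (boxVec L r)) ^ 2 ≤ (L : ℝ) ^ d * ((d : ℝ) * L * β) ^ 2 := by
    calc ∑ r : Fin d → Fin L, lnorm ψ y (treeWord (boxVec L r)) ^ 2 ≤ ∑ _r : Fin d → Fin L, ((d : ℝ) * L * β) ^ 2 :=
          Finset.sum_le_sum fun r _ => pow_le_pow_left₀ (h0 r) (htree r) 2
      _ = (L : ℝ) ^ d * ((d : ℝ) * L * β) ^ 2 := by rw [Finset.sum_const, hcard, nsmul_eq_mul]; push_cast; ring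
  have hLd : (0 : ℝ) < (L : ℝ) ^ d := pow_pos (by exact_mod_cast (by omega : 0 < L)) d
  calc 2 * ((L : ℝ) ^ d)⁻¹ * ∑ r : Fin d → Fin L, lnorm ψ y (treeWord (boxVec L r)) ^ 2
      ≤ 2 * ((L : ℝ) ^ d)⁻¹ * ((L : ℝ) ^ d * ((d : ℝ) * L * β) ^ 2) := mul_le_mul_of_nonneg_left hsum (by positivity)
    _ = 2 * ((d : ℝ) * L * β) ^ 2 := by field_simp

end

end Summit.QuantumFields.BalabanUV.T4Continuum.NE7BlockFrameSecondOrder
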